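import Mathlib

/-!
# HOME DRAFT — TN-GR resolution candidate (GR-b′) «VOID BY GLOBAL GAUGE SYMMETRY»: the anchored gradient at the flat configuration vanishes

`CURRENCY-MEMO-g26.md` v2.2 §10.3; LEAD WORD №15 (3) ((GR-a) chosen; (GR-b) via charge conjugation is not a one-liner); critic #570∕#573.
OBSERVATION.  Let `R` be GAUGE-INVARIANT and let `W(v)` be the flat configuration `1` with the single bond `b` excited to `expPt v`.  A GLOBAL
(constant) gauge rotation `h₀` fixes `1` and conjugates the excitation: `W(v)^{h₀} = W(Ad(h₀) v)` (Ad-equivariance of the exponential chart).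
Hence `v ↦ R(W(v))` is `Ad(SU(2)) = SO(3)`-invariant on `su(2) ≅ ℝ³`; every `v` is mapped to `−v` by a rotation by `π` about an axis `⊥ v`,
so `v ↦ R(W(v))` is EVEN; an even function differentiable at `0` has ZERO differential there (`fderiv_zero_of_even` below).  So the anchored
gradient letters `g⁰_b` of (GR-a) VANISH IDENTICALLY at the anchor `U⁰ = 1` for every gauge-invariant `R` differentiable at the flat
configuration along one-bond moves — at EVERY height, for input and output alike: the gradient channel carries no letter and needs no transport;
what remains of TN-GR is the PATH FACTOR N(U) × column mass of `k` (`GRTelescope.firstDiff_of_anchor_and_length` with `g₀ = 0`).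
This file proves the two abstract lemmas; the organ-level facts it rests on are LISTED, NOT PROVED: (i) gauge invariance of `log ρ_j`, `log ρ′_j`
pointwise on the window (densities of gauge-invariant laws w.r.t. product Haar, `ContinuousOn` on the window; `descend` gauge-covariant);
(ii) Ad-equivariance of `T4CubeChartExp.expPt` (`expPt (Ad h₀ v) = h₀ * expPt v * h₀⁻¹` in the tree's coordinates `toE`); (iii) for every
`v : Fin 3 → ℝ` a global `h₀ : SU2` with `Ad h₀ v = −v`; (iv) differentiability of `v ↦ R(W(v))` at `0` — from the analyticity predicate (β).
HONEST: abstract calculus, kernel-checked; (i)–(iv) are g27's organ-level lemmas; nothing about the runs is proved; nothing of O1∕O1ᵘ-H∕S3∕20520∕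
`YM3TorusSU2` is proved; registry №36 intact; R3 = SU(2) YM₃ on T³ — NOT d = 4, NOT infinite volume, NOT a mass gap, NOT Clay.
-/

namespace Summit.QuantumFields.YangMills.Cruxes.FluctuationComparisonRegPrIntL.GREven

variable {E : Type*} [NormedAddCommGroup E]

/-- Invariance under a family of maps that can flip every vector makes a function even. -/
theorem even_of_invariant_flip {G : Type*} (act : G → E → E) (f : E → ℝ)
    (hinv : ∀ (g : G) (v : E), f (act g v) = f v) (hflip : ∀ v : E, ∃ g : G, act g v = -v) :
    ∀ v : E, f (-v) = f v := by
  intro v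
  obtain ⟨g, hg⟩ := hflip v
  rw [← hg, hinv]

variable [NormedSpace ℝ E]

/-- ★ An EVEN function differentiable at `0` has zero Fréchet derivative at `0`. -/
theorem fderiv_zero_of_even (f : E → ℝ) (heven : ∀ v : E, f (-v) = f v) (hd : DifferentiableAt ℝ f 0) :
    fderiv ℝ f 0 = 0 := by
  set L : E →L[ℝ] ℝ := fderiv ℝ f 0 with hL
  have h : HasFDerivAt f L 0 := hd.hasFDerivAt
  -- derivative of `f ∘ neg` at 0
  have hneg : HasFDerivAt (fun v : E => -v) (-(ContinuousLinearMap.id ℝ E)) (0 : E) := (hasFDerivAt_id (0 : E)).neg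
  have h0 : HasFDerivAt f L ((fun v : E => -v) 0) := by simpa using h
  have hcomp : HasFDerivAt (f ∘ fun v : E => -v) (L.comp (-(ContinuousLinearMap.id ℝ E))) 0 := h0.comp 0 hneg
  have hfe : (f ∘ fun v : E => -v) = f := funext fun v => heven v
  rw [hfe] at hcomp
  have huniq : L = L.comp (-(ContinuousLinearMap.id ℝ E)) := h.unique hcomp
  ext v
  have hv : L v = L (-v) := by
    have := congrArg (fun T : E →L[ℝ] ℝ => T v) huniq
    simpa using this
  have hv' : L (-v) = -L v := map_neg L v
  rw [hv'] at hv
  have hz : L v = 0 := by linarith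
  simpa using hz

/-- Directional form: every directional derivative of an even function at `0` vanishes. -/
theorem fderiv_apply_zero_of_even (f : E → ℝ) (heven : ∀ v : E, f (-v) = f v) (hd : DifferentiableAt ℝ f 0) (w : E) :
    fderiv ℝ f 0 w = 0 := by
  simp [fderiv_zero_of_even f heven hd]

/-- ★★ (GR-b′) ABSTRACT FORM: a function invariant under a vector-flipping family of maps (global gauge rotations acting by `Ad` on the bond
tangent space) and differentiable at `0` has zero gradient at `0` — the anchored gradient letter vanishes. -/
theorem fderiv_zero_of_invariant_flip {G : Type*} (act : G → E → E) (f : E → ℝ)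
    (hinv : ∀ (g : G) (v : E), f (act g v) = f v) (hflip : ∀ v : E, ∃ g : G, act g v = -v) (hd : DifferentiableAt ℝ f 0) :
    fderiv ℝ f 0 = 0 :=
  fderiv_zero_of_even f (even_of_invariant_flip act f hinv hflip) hd

end Summit.QuantumFields.YangMills.Cruxes.FluctuationComparisonRegPrIntL.GREven
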